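import Literature.NumberTheory.Transcendental.GelfondExpLogConjectureProofs
import HarnessLib

/-!
# Arbitrary base branches, LXXXII: an ALGEBRAIC direction is never resonant when the pole orders
# differ (Lindemann)

HONEST FRAMING.  Cell `pub-schanuel` (Zilber's Exponential-Algebraic Closedness, case ladder;
host summit Schanuel), seat 2, gen 32.  Step E4 (second half) of the roadmap "every curve over
`ℚ̄`".  The density engines of files XIX/XXXII (growth), LXXII/LXXVIII/LXXIX (Kronecker) need, for
SOME `k`-th root `z` of `2πi`, that the top phase `θz^M` have nonzero real part or an imaginary
part that is an irrational multiple of `2π`.  If both fail then `θz^M = r·2πi` with `r ∈ ℚ`,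
`r ≠ 0`, hence `θ^k(2πi)^M = r^k(2πi)^k` and `(2πi)^{|M−k|} = (θ/r)^{±k}` is algebraic when `θ` is:
for `M ≠ k` this makes `πi` algebraic, contradicting Lindemann (tree fact
`Literature.NumberTheory.Transcendental.transcendental_pi_mul_I`).  Hence
**`not_resonant_of_isAlgebraic`**: `θ ≠ 0` algebraic, `M ≠ k` ⟹ every `k`-th root `z` of `2πi`
is non-resonant.  [folklore + Lindemann]; nothing here is specific to Schanuel's conjecture
(neither used nor implied); Mantova–Masser's question and EC(3,2) stay OPEN.
-/

noncomputable section

open Complex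

set_option linter.dupNamespace false

namespace Summit.Schanuel.Schanuel.Theorems

/-- `2πi·(πi)`-arithmetic: if `(2πi)^m` is algebraic for some `m ≥ 1` then `πi` is algebraic —
impossible (Lindemann). [cite: Lindemann1882] -/
theorem not_isAlgebraic_two_pi_I_pow {m : ℕ} (hm : 1 ≤ m) :
    ¬ IsAlgebraic ℚ ((2 * Real.pi * I : ℂ) ^ m) := by
  intro h
  have h1 : IsAlgebraic ℚ (2 * Real.pi * I : ℂ) := IsAlgebraic.of_pow (by omega) h
  have h2 : IsAlgebraic ℚ ((Real.pi : ℂ) * I) := by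
    rw [← mem_algebraicClosure_iff] at h1 ⊢
    have htwo : (2 : ℂ)⁻¹ ∈ algebraicClosure ℚ ℂ := inv_mem (ofNat_mem _ 2)
    have h3 := mul_mem htwo h1
    have e : (2 : ℂ)⁻¹ * (2 * Real.pi * I) = (Real.pi : ℂ) * I := by field_simp
    rwa [e] at h3
  exact Literature.NumberTheory.Transcendental.transcendental_pi_mul_I h2

/-- **An algebraic direction is never resonant when `M ≠ k`.**  `θ ≠ 0` algebraic over `ℚ`,
`k ≥ 1`, `M ≠ k`, `z^k = 2πi` ⟹ `Re(θz^M) ≠ 0` or `Im(θz^M)/2π ∉ ℚ`. [cite: Lindemann1882] -/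
theorem not_resonant_of_isAlgebraic {θ : ℂ} (hθalg : IsAlgebraic ℚ θ) (hθ0 : θ ≠ 0) {k M : ℕ}
    (hk : 1 ≤ k) (hMk : M ≠ k) {z : ℂ} (hz : z ^ k = 2 * Real.pi * I) :
    (θ * z ^ M).re ≠ 0 ∨ Irrational ((θ * z ^ M).im / (2 * Real.pi)) := by
  classical
  by_contra h
  push Not at h
  obtain ⟨hre, hirr⟩ := h
  have h2πI : (2 * Real.pi * I : ℂ) ≠ 0 := by simp [Real.pi_ne_zero, Complex.I_ne_zero]
  have hz0 : z ≠ 0 := by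
    rintro rfl
    rw [zero_pow (by omega)] at hz
    exact h2πI hz.symm
  obtain ⟨r, hr⟩ : ∃ r : ℚ, (r : ℝ) = (θ * z ^ M).im / (2 * Real.pi) := by
    unfold Irrational at hirr
    push Not at hirr
    exact hirr
  have hπ : (0 : ℝ) < 2 * Real.pi := by positivity
  have him : (θ * z ^ M).im = (r : ℝ) * (2 * Real.pi) := by
    rw [hr]; field_simp
  -- `θ z^M = r · 2πi`
  have hval : θ * z ^ M = (r : ℂ) * (2 * Real.pi * I) := by
    refine Complex.ext ?_ ?_
    · rw [hre]; simp
    · rw [him]; simp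
  have hr0 : r ≠ 0 := by
    rintro rfl
    have : θ * z ^ M = 0 := by rw [hval]; simp
    exact (mul_ne_zero hθ0 (pow_ne_zero _ hz0)) this
  have hrC : (r : ℂ) ≠ 0 := by exact_mod_cast hr0
  -- `θ^k (2πi)^M = r^k (2πi)^k`
  have hpow : θ ^ k * (2 * Real.pi * I) ^ M = (r : ℂ) ^ k * (2 * Real.pi * I) ^ k := by
    have h1 : (θ * z ^ M) ^ k = ((r : ℂ) * (2 * Real.pi * I)) ^ k := by rw [hval]
    have e1 : (θ * z ^ M) ^ k = θ ^ k * (2 * Real.pi * I) ^ M := by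
      rw [mul_pow, ← pow_mul, mul_comm M k, pow_mul, hz]
    have e2 : ((r : ℂ) * (2 * Real.pi * I)) ^ k = (r : ℂ) ^ k * (2 * Real.pi * I) ^ k :=
      mul_pow _ _ _
    rw [e1, e2] at h1
    exact h1
  -- algebraicity bookkeeping in the subfield `algebraicClosure ℚ ℂ`
  set A := algebraicClosure ℚ ℂ with hA
  have hθA : θ ∈ A := mem_algebraicClosure_iff.2 hθalg
  have hrA : (r : ℂ) ∈ A := by
    have : IsAlgebraic ℚ ((r : ℚ) : ℂ) := isAlgebraic_algebraMap r
    exact mem_algebraicClosure_iff.2 (by simpa using this)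
  rcases Nat.lt_or_gt_of_ne hMk with hlt | hgt
  · -- `M < k`: `(2πi)^(k−M) = θ^k / r^k`
    have hq : (2 * Real.pi * I : ℂ) ^ (k - M) = θ ^ k / (r : ℂ) ^ k := by
      rw [eq_div_iff (pow_ne_zero _ hrC)]
      have e : (2 * Real.pi * I : ℂ) ^ k = (2 * Real.pi * I) ^ M * (2 * Real.pi * I) ^ (k - M) := by
        rw [← pow_add, Nat.add_sub_cancel' hlt.le]
      have h1 := hpow
      rw [e] at h1
      have h2 := mul_left_cancel₀ (pow_ne_zero M h2πI)
        (show (2 * Real.pi * I : ℂ) ^ M * θ ^ k =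
          (2 * Real.pi * I) ^ M * ((r : ℂ) ^ k * (2 * Real.pi * I) ^ (k - M)) by
          rw [mul_comm, h1]; ring)
      rw [h2]; ring
    have hmem : (2 * Real.pi * I : ℂ) ^ (k - M) ∈ A := by
      rw [hq]
      exact div_mem (pow_mem hθA k) (pow_mem hrA k)
    exact not_isAlgebraic_two_pi_I_pow (by omega) (mem_algebraicClosure_iff.1 hmem)
  · -- `M > k`: `(2πi)^(M−k) = r^k / θ^k`
    have hθk : θ ^ k ≠ 0 := pow_ne_zero _ hθ0
    have hq : (2 * Real.pi * I : ℂ) ^ (M - k) = (r : ℂ) ^ k / θ ^ k := by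
      rw [eq_div_iff hθk]
      have e : (2 * Real.pi * I : ℂ) ^ M = (2 * Real.pi * I) ^ k * (2 * Real.pi * I) ^ (M - k) := by
        rw [← pow_add, Nat.add_sub_cancel' hgt.le]
      have h1 := hpow
      rw [e] at h1
      have h2 := mul_left_cancel₀ (pow_ne_zero k h2πI)
        (show (2 * Real.pi * I : ℂ) ^ k * ((2 * Real.pi * I) ^ (M - k) * θ ^ k) =
          (2 * Real.pi * I) ^ k * (r : ℂ) ^ k by
          rw [mul_comm ((2 * Real.pi * I : ℂ) ^ k) ((r : ℂ) ^ k), ← h1]; ring)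
      rw [h2]
    have hmem : (2 * Real.pi * I : ℂ) ^ (M - k) ∈ A := by
      rw [hq]
      exact div_mem (pow_mem hrA k) (pow_mem hθA k)
    exact not_isAlgebraic_two_pi_I_pow (by omega) (mem_algebraicClosure_iff.1 hmem)

end Summit.Schanuel.Schanuel.Theorems

end
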